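import Summits.BirchSwinnertonDyer.BirchSwinnertonDyer.Theorems.GenusKolyvaginAtTwoTorsionCellD0TripleTwistEight
import Summits.BirchSwinnertonDyer.BirchSwinnertonDyer.Theorems.GenusKolyvaginAtTwoTorsionCellD0ParitySigns
import HarnessLib

/-!
# D0≤2, parity of the genus twist, V: the two Selmer groups in the frame of the relaxed group

Crux R″ `RankOneTwoTorsionResidualAtTwo` (stmt-27478), LINE 49 «full_vertex», stub D0≤2
`FullTorsionGenusSelmerLawUpToTwoAtTwo`, slice `#Q₀ = 2`, the `2`-PARITY HALF of `#Sel⁽²⁾(E₀^{(−p₀q₁q₂)}) = 8`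
made UNCONDITIONAL (setting of `…D0TripleTwistBound`: `E/ℚ`, rational `2`-torsion `e₁ < e₂ < e₃`, good reduction off
`S ∋ 2`, primes `p, q₁, q₂ ∉ S`, `d = −pq₁q₂` a square at every place of `S`).

In Klagsbrun–Mazur–Rubin's argument both `Sel⁽²⁾(E)` and `Sel⁽²⁾(E^{(d)})` are cut out of the RELAXED group
`R = {c : components supported on S ∪ {p,q₁,q₂}, E's local condition at the primes of S}` by LINEAR conditions in the
bits of the components at the four places `∞, p, q₁, q₂` where the two families of local conditions differ:

* `mem_selmerGroup_iff_frame` — `c ∈ Sel⁽²⁾(E)` iff `c ∈ R`, the parities at `p, q₁, q₂` vanish and `a > 0`;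
* `twist_mem_selmerGroup_of_frame` / `frame_of_twist_mem_selmerGroup` — `c_{E^{(d)}}(a, b) ∈ Sel⁽²⁾(E^{(d)})` iff
  `c_E(a, b) ∈ R`, the `I₀*` relations of `qrBit_rel_quadraticTwist_of_mem_selmerGroup` hold at `p, q₁, q₂`, and
  `sgn a = sgn b`.

Everything is proved; no LINE 49 statement is restated; BSD is not advanced by this file alone.

## References

* [KlagsbrunMazurRubin2013] Z. Klagsbrun, B. Mazur, K. Rubin, Ann. of Math. 178 (2013), Def. 3.8, Thm. 3.9.
* [SilvermanAEC2009] J. H. Silverman, *The Arithmetic of Elliptic Curves*, 2nd ed., Prop. X.1.4, Prop. X.4.9.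
* [MazurRubin2010] B. Mazur, K. Rubin, Invent. Math. 181 (2010), Lemma 2.10, Lemma 2.11.
-/

noncomputable section

open scoped Classical

namespace Summit.BirchSwinnertonDyer.BirchSwinnertonDyer.Theorems.GenusKolyvaginAtTwo.TorsionCellD0

open WeierstrassCurve WeierstrassCurve.Affine WeierstrassCurve.Affine.Point
open Literature.NumberTheory.GaloisRepresentations Literature.NumberTheory.EllipticCurves Field
open Literature.NumberTheory.EllipticCurves.TwoDescentLocal
open Literature.NumberTheory.EllipticCurves.KramerTwoDescent
open Literature.NumberTheory.QuadraticForms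
open IsDedekindDomain NumberField Rat.HeightOneSpectrum

variable (E : WeierstrassCurve ℚ) [E.IsElliptic] {e₁ e₂ e₃ : ℚ}
variable (S : Finset ℕ) {p q₁ q₂ : ℕ} [hp : Fact p.Prime] [hq₁ : Fact q₁.Prime] [hq₂ : Fact q₂.Prime]

/-! ## §1 Unit integral representatives at a prime of even valuation -/

omit hp hq₁ hq₂ in
/-- A rational of even `ℓ`-adic valuation is, up to a square, an integer prime to `ℓ`. [folklore] -/
theorem exists_unit_int_rep {ℓ : ℕ} [Fact ℓ.Prime] (a : ℚˣ) (hpar : parityBit ℓ (a : ℚ) = 0) :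
    ∃ (m : ℤ) (hm0 : (m : ℚ) ≠ 0), ¬ ((ℓ : ℕ) : ℤ) ∣ m ∧
      (QuotientGroup.mk a : SqUnits ℚ) = QuotientGroup.mk (Units.mk0 (m : ℚ) hm0) := by
  obtain ⟨A, c, hA0, hc, hAc⟩ := Rat.exists_mul_sq_eq_intCast a.ne_zero
  have heven : Even (padicValInt ℓ A) :=
    even_padicValInt_of_parityBit_eq_zero (ℓ := ℓ) ((bits_eq_of_mul_sq_eq (ℓ := ℓ) a.ne_zero hc hAc).1 ▸ hpar)
  obtain ⟨k, hk⟩ := heven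
  set m := primeCompl ℓ A with hm
  have hm0Z : m ≠ 0 := primeCompl_ne_zero (p := ℓ) hA0
  have hm0 : (m : ℚ) ≠ 0 := by exact_mod_cast hm0Z
  have hdec : (A : ℚ) = ((ℓ : ℚ) ^ k) ^ 2 * (m : ℚ) := by
    have := pow_padicValInt_mul_primeCompl ℓ A
    rw [hk] at this
    have : (A : ℚ) = ((ℓ : ℚ) ^ (k + k)) * (m : ℚ) := by exact_mod_cast this.symm
    rw [this]; ring
  refine ⟨m, hm0, not_dvd_primeCompl (p := ℓ) hA0, ?_⟩
  have hl0 : ((ℓ : ℚ) ^ k) ≠ 0 := pow_ne_zero _ (by exact_mod_cast (Fact.out : ℓ.Prime).ne_zero)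
  have ha0 := a.ne_zero
  have key : (a : ℚ) * (c / (ℓ : ℚ) ^ k) ^ 2 = m := by
    calc (a : ℚ) * (c / (ℓ : ℚ) ^ k) ^ 2 = ((a : ℚ) * c ^ 2) / ((ℓ : ℚ) ^ k) ^ 2 := by ring
      _ = (m : ℚ) := by rw [hAc, hdec]; field_simp
  refine QuotientGroup.eq.mpr ⟨Units.mk0 (c / (ℓ : ℚ) ^ k) (div_ne_zero hc hl0), Units.ext ?_⟩
  rw [powMonoidHom_apply, Units.val_pow_eq_pow_val, Units.val_mk0, Units.val_mul, Units.val_inv_eq_inv_val,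
    Units.val_mk0, ← key, ← mul_assoc, inv_mul_cancel₀ ha0, one_mul]

/-! ## §2 `Sel⁽²⁾(E)` in the frame -/

/-- **`Sel⁽²⁾(E)` cut out of the relaxed group**: for `c ∈ H¹(ℚ, E[2])` with components `[a], [b]`,
`c ∈ Sel⁽²⁾(E/ℚ)` iff the components have even valuation at every prime outside `S` (in particular at `p, q₁, q₂`),
`c` satisfies `E`'s local condition at the primes of `S`, and `a > 0` (the real condition for `e₁ < e₂ < e₃`).
[cite: SilvermanAEC2009, Prop. X.1.4, Prop. X.4.9] -/
theorem mem_selmerGroup_iff_frame (h : E.toAffine.SplitTwoTorsion e₁ e₂ e₃) (h2S : 2 ∈ S) (h12 : e₁ < e₂) (h23 : e₂ < e₃)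
    (hgood : ∀ ℓ : ℕ, (hℓ : ℓ.Prime) → ℓ ∉ S → haveI : Fact ℓ.Prime := ⟨hℓ⟩;
      padicValRat ℓ (e₁ - e₂) = 0 ∧ padicValRat ℓ (e₁ - e₃) = 0 ∧ padicValRat ℓ (e₂ - e₃) = 0)
    (hN : ∀ ℓ : ℕ, ℓ.Prime → ℓ ∉ S → ¬ ℓ ∣ E.conductorNorm ℤ)
    {c : galH1Torsion E 2} (a b : ℚˣ) (ha : kummerEquiv ℚ 2 (E.twoTorsionCharH1 h c) = Additive.ofMul (QuotientGroup.mk a))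
    (hb : kummerEquiv ℚ 2 (E.twoTorsionCharH1 h.swap₁₂ c) = Additive.ofMul (QuotientGroup.mk b)) :
    c ∈ selmerGroup E 2 ↔
      ((∀ ℓ : ℕ, (hℓ : ℓ.Prime) → ℓ ∉ S → haveI : Fact ℓ.Prime := ⟨hℓ⟩; parityBit ℓ (a : ℚ) = 0 ∧ parityBit ℓ (b : ℚ) = 0) ∧
        (∀ v : HeightOneSpectrum (𝓞 ℚ), natGenerator v ∈ S → c ∈ selmerLocalKer E (v.adicCompletion ℚ) 2) ∧
        signBit (a : ℚ) = 0) := by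
  have hc_eq : c = E.twoDescentClass h a b := E.eq_twoDescentClass_of_kummerEquiv_eq h a b ha hb
  constructor
  · intro hc
    refine ⟨fun ℓ hℓ hℓS => ?_, fun v _ => ((E.mem_selmerGroup_iff 2 c).mp hc).1 v, ?_⟩
    · haveI : Fact ℓ.Prime := ⟨hℓ⟩
      obtain ⟨g12, g13, g23⟩ := hgood ℓ hℓ hℓS
      set v : HeightOneSpectrum (𝓞 ℚ) := (primesEquiv (R := 𝓞 ℚ)).symm ⟨ℓ, hℓ⟩ with hv
      have hgen : (primesEquiv (R := 𝓞 ℚ) v : ℕ) = ℓ := congrArg Subtype.val ((primesEquiv (R := 𝓞 ℚ)).apply_symm_apply ⟨ℓ, hℓ⟩)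
      have ea := E.even_padicValRat_of_mem_selmerGroup h hc v (by rw [hgen]; exact g12) (by rw [hgen]; exact g13) a ha
      have eb := E.even_padicValRat_of_mem_selmerGroup h.swap₁₂ hc v
        (by rw [hgen, ← neg_sub, padicValRat.neg]; exact g12) (by rw [hgen]; exact g23) b hb
      rw [hgen] at ea eb
      exact ⟨parityBit_eq_zero_iff.mpr ea, parityBit_eq_zero_iff.mpr eb⟩
    · exact (signBit_eq_zero_iff a.ne_zero).mpr (E.pos_of_mem_selmerGroup_of_lt h h12 (h12.trans h23) hc a ha)
  · rintro ⟨hsupp, hloc, hsign⟩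
    rw [E.mem_selmerGroup_iff]
    refine ⟨fun v => ?_, fun w => ?_⟩
    · by_cases hvS : natGenerator v ∈ S
      · exact hloc v hvS
      · have hℓ := prime_natGenerator v
        haveI : Fact (natGenerator v).Prime := ⟨hℓ⟩
        have hℓ2 : (primesEquiv (R := 𝓞 ℚ) v : ℕ) ≠ 2 := fun h2 => hvS (by rw [show natGenerator v = 2 from h2]; exact h2S)
        have hgoodv : E.HasGoodReductionAt v := by
          by_contra hbad; exact hN _ hℓ hvS ((E.dvd_conductorNorm_iff v).mpr hbad)
        obtain ⟨hpa, hpb⟩ := hsupp (natGenerator v) hℓ hvS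
        obtain ⟨m, hm0, hmd, hma⟩ := exists_unit_int_rep (ℓ := natGenerator v) a hpa
        obtain ⟨m', hm0', hmd', hmb⟩ := exists_unit_int_rep (ℓ := natGenerator v) b hpb
        rw [hc_eq]
        exact E.twoDescentClass_mem_selmerLocalKer_of_mk_eq_intCast h v hℓ2 hgoodv a b m m' hm0 hm0' hma hmb hmd hmd'
    · have hapos : 0 < (a : ℚ) := (signBit_eq_zero_iff a.ne_zero).mp hsign
      rw [hc_eq]
      rcases lt_or_gt_of_ne b.ne_zero with hbn | hbp
      · -- `b < 0`: `c ≡ κ(T₁)` at `∞`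
        refine twoDescentClass_mem_selmerLocalKer_of_isSquare_T₁ E h _
          (charZero_of_injective_algebraMap (algebraMap ℚ _).injective) a b ?_ ?_
        · exact isSquare_algebraMap_completion_of_pos w (mul_pos hapos (mul_pos_of_neg_of_neg (by linarith) (by linarith)))
        · exact isSquare_algebraMap_completion_of_pos w (mul_pos_of_neg_of_neg hbn (by linarith))
      · exact twoDescentClass_mem_selmerLocalKer_of_isSquare E h _ (charZero_of_injective_algebraMap (algebraMap ℚ _).injective)
          a b (isSquare_algebraMap_completion_of_pos w hapos) (isSquare_algebraMap_completion_of_pos w hbp)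

/-! ## §3 `Sel⁽²⁾(E^{(d)})` in the frame -/

/-- The `I₀*` relations at a twisting prime are additive in the pair. [folklore] -/
private theorem rel_mul {q : ℕ} [Fact q.Prime] {κ κ' δ₁ δ₂ : ZMod 2} {a b a' b' : ℚ} (ha : a ≠ 0) (hb : b ≠ 0)
    (ha' : a' ≠ 0) (hb' : b' ≠ 0)
    (h1 : qrBit q a = parityBit q a * κ + parityBit q b * δ₁ ∧ qrBit q b = parityBit q a * δ₂ + parityBit q b * κ')
    (h2 : qrBit q a' = parityBit q a' * κ + parityBit q b' * δ₁ ∧ qrBit q b' = parityBit q a' * δ₂ + parityBit q b' * κ') :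
    qrBit q (a * a') = parityBit q (a * a') * κ + parityBit q (b * b') * δ₁ ∧
      qrBit q (b * b') = parityBit q (a * a') * δ₂ + parityBit q (b * b') * κ' := by
  rw [qrBit_mul q ha ha', qrBit_mul q hb hb', parityBit_mul ha ha', parityBit_mul hb hb', h1.1, h1.2, h2.1, h2.2]
  constructor <;> ring

/-- **`Sel⁽²⁾(E^{(d)})` from the frame conditions** (sufficiency).  Setting of `…D0TripleTwistBound`; for `a, b ∈ ℚˣ`
with even valuations off `S ∪ {p,q₁,q₂}`, `c_E(a,b)` in `E`'s local condition at the primes of `S`, the `I₀*` relations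
at `p, q₁, q₂` (`qr_q(a) = v_q(a)(qr_q(d) + qr_q(e₂−e₁)) + v_q(b) qr_q(D₁)`, `qr_q(b) = v_q(a) qr_q(D₂) + v_q(b)(qr_q(d) + qr_q(e₁−e₂))`)
and `sgn a = sgn b`, the class `c_{E^{(d)}}(a, b)` is Selmer.  At a twisting prime: a rational torsion pair `(t₁,t₂)`
evens the valuations, the relations then force `a t₁, b t₂` to be `q`-adic squares.
[cite: SilvermanAEC2009, Prop. X.1.4, Prop. X.4.9] [cite: MazurRubin2010, Lemma 2.10, Lemma 2.11] -/
theorem twist_mem_selmerGroup_of_frame (h : E.toAffine.SplitTwoTorsion e₁ e₂ e₃) (h2S : 2 ∈ S)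
    (h12 : e₁ < e₂) (h23 : e₂ < e₃)
    (hgood : ∀ ℓ : ℕ, (hℓ : ℓ.Prime) → ℓ ∉ S → haveI : Fact ℓ.Prime := ⟨hℓ⟩;
      padicValRat ℓ (e₁ - e₂) = 0 ∧ padicValRat ℓ (e₁ - e₃) = 0 ∧ padicValRat ℓ (e₂ - e₃) = 0)
    (hN : ∀ ℓ : ℕ, ℓ.Prime → ℓ ∉ S → ¬ ℓ ∣ E.conductorNorm ℤ)
    (hpS : p ∉ S) (hq₁S : q₁ ∉ S) (hq₂S : q₂ ∉ S) (hpq₁ : p ≠ q₁) (hpq₂ : p ≠ q₂) (hne : q₁ ≠ q₂)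
    (hp8 : p % 8 = 7) (hq₁4 : q₁ % 4 = 3) (hq₂4 : q₂ % 4 = 3) (hM8 : ((q₁ : ℤ) * q₂) % 8 = 1)
    (hsplitp : ∀ ℓ ∈ S, (hℓ : ℓ.Prime) → ℓ ≠ 2 → haveI : Fact ℓ.Prime := ⟨hℓ⟩; legendreSym ℓ (-(p : ℤ)) = 1)
    (hsplitM : ∀ ℓ ∈ S, (hℓ : ℓ.Prime) → ℓ ≠ 2 → haveI : Fact ℓ.Prime := ⟨hℓ⟩; legendreSym ℓ ((q₁ : ℤ) * q₂) = 1)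
    {d : ℚ} (hd : d = -(p : ℚ) * ((q₁ : ℚ) * q₂)) [(E.quadraticTwist d).IsElliptic] (a b : ℚˣ)
    (hsupp : ∀ ℓ : ℕ, (hℓ : ℓ.Prime) → ℓ ∉ S → ℓ ≠ p → ℓ ≠ q₁ → ℓ ≠ q₂ → haveI : Fact ℓ.Prime := ⟨hℓ⟩;
      parityBit ℓ (a : ℚ) = 0 ∧ parityBit ℓ (b : ℚ) = 0)
    (hloc : ∀ v : HeightOneSpectrum (𝓞 ℚ), natGenerator v ∈ S →
      E.twoDescentClass h a b ∈ selmerLocalKer E (v.adicCompletion ℚ) 2)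
    (hrel : ∀ q : ℕ, (hq : q.Prime) → (q = p ∨ q = q₁ ∨ q = q₂) → haveI : Fact q.Prime := ⟨hq⟩;
      qrBit q (a : ℚ) = parityBit q (a : ℚ) * (qrBit q d + qrBit q (e₂ - e₁)) +
          parityBit q (b : ℚ) * qrBit q ((e₁ - e₂) * (e₁ - e₃)) ∧
        qrBit q (b : ℚ) = parityBit q (a : ℚ) * qrBit q ((e₂ - e₁) * (e₂ - e₃)) +
          parityBit q (b : ℚ) * (qrBit q d + qrBit q (e₁ - e₂)))
    (hsign : signBit (a : ℚ) = signBit (b : ℚ)) :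
    (E.quadraticTwist d).twoDescentClass (h.quadraticTwist d) a b ∈ selmerGroup (E.quadraticTwist d) 2 := by
  have h' := h.quadraticTwist d
  have hp0 : (0 : ℚ) < p := by exact_mod_cast hp.out.pos
  have hq₁0 : (0 : ℚ) < q₁ := by exact_mod_cast hq₁.out.pos
  have hq₂0 : (0 : ℚ) < q₂ := by exact_mod_cast hq₂.out.pos
  have hdneg : d < 0 := by rw [hd]; nlinarith [mul_pos hq₁0 hq₂0]
  have hd0 : d ≠ 0 := hdneg.ne
  -- the twisting primes: torsion normalisation, then both components are squares
  have twist_case : ∀ (q : ℕ) [Fact q.Prime] (v : HeightOneSpectrum (𝓞 ℚ)), (primesEquiv (R := 𝓞 ℚ) v : ℕ) = q →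
      q ≠ 2 → q ∉ S → padicValRat q d = 1 →
      (qrBit q (a : ℚ) = parityBit q (a : ℚ) * (qrBit q d + qrBit q (e₂ - e₁)) +
          parityBit q (b : ℚ) * qrBit q ((e₁ - e₂) * (e₁ - e₃)) ∧
        qrBit q (b : ℚ) = parityBit q (a : ℚ) * qrBit q ((e₂ - e₁) * (e₂ - e₃)) +
          parityBit q (b : ℚ) * (qrBit q d + qrBit q (e₁ - e₂))) →
      (E.quadraticTwist d).twoDescentClass h' a b ∈ selmerLocalKer (E.quadraticTwist d) (v.adicCompletion ℚ) 2 := by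
    intro q _ v hvq hq2 hqS hqd hrel_ab
    obtain ⟨g12, g13, g23⟩ := hgood q Fact.out hqS
    obtain ⟨t₁, t₂, ht, hpa, hpb⟩ :=
      E.exists_torsionPair_quadraticTwist_parityBit_mul_eq_zero h (d := d) hqd g12 g13 g23 a b
    have hrel_t := E.qrBit_rel_quadraticTwist_of_mem_selmerGroup h hqd g12 g13 g23 ht t₁ t₂
      ((E.quadraticTwist d).kummerEquiv_twoTorsionCharH1_twoDescentClass h' t₁ t₂)
      ((E.quadraticTwist d).kummerEquiv_twoTorsionCharH1_swap_twoDescentClass h' t₁ t₂)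
    obtain ⟨r1, r2⟩ := rel_mul (q := q) a.ne_zero b.ne_zero t₁.ne_zero t₂.ne_zero hrel_ab hrel_t
    rw [hpa, hpb, zero_mul, zero_mul, zero_add] at r1 r2
    have hsqa : IsSquare (algebraMap ℚ (v.adicCompletion ℚ) ((a * t₁ : ℚˣ) : ℚ)) := by
      rw [Units.val_mul]
      exact isSquare_algebraMap_adicCompletion_of_bits v hvq hq2 (mul_ne_zero a.ne_zero t₁.ne_zero) hpa r1
    have hsqb : IsSquare (algebraMap ℚ (v.adicCompletion ℚ) ((b * t₂ : ℚˣ) : ℚ)) := by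
      rw [Units.val_mul]
      exact isSquare_algebraMap_adicCompletion_of_bits v hvq hq2 (mul_ne_zero b.ne_zero t₂.ne_zero) hpb r2
    have hmem := twoDescentClass_mem_selmerLocalKer_of_isSquare (E.quadraticTwist d) h' _
      (charZero_of_injective_algebraMap (algebraMap ℚ _).injective) (a * t₁) (b * t₂) hsqa hsqb
    rw [twoDescentClass_mul (E.quadraticTwist d) h'] at hmem
    have ht_loc := ((mem_selmerGroup_iff _ _ _).mp ht).1 v
    have := sub_mem hmem ht_loc
    rwa [add_sub_cancel_right] at this
  rw [mem_selmerGroup_iff]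
  refine ⟨fun v => ?_, fun w => ?_⟩
  · by_cases hvS : natGenerator v ∈ S
    · -- places of `S`: `d` is a square, the two curves have the same local condition
      have hsq := isSquare_negTriple_adicCompletion S hpS hq₁S hq₂S hp8 hq₁4 hq₂4 hM8 hsplitp hsplitM v hvS
      rw [← hd] at hsq
      exact (E.twoDescentClass_quadraticTwist_mem_selmerLocalKer_iff (v.adicCompletion ℚ)
        (charZero_of_injective_algebraMap (algebraMap ℚ _).injective) h hsq a b).mpr (hloc v hvS)
    · have hℓ := prime_natGenerator v
      have hℓ2 : natGenerator v ≠ 2 := fun h2 => hvS (h2 ▸ h2S)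
      by_cases hvp : natGenerator v = p
      · exact twist_case p v hvp (hvp ▸ hℓ2) hpS (by rw [hd]; exact padicValRat_negTriple_p hpq₁ hpq₂)
          (hrel p hp.out (Or.inl rfl))
      by_cases hv₁ : natGenerator v = q₁
      · exact twist_case q₁ v hv₁ (hv₁ ▸ hℓ2) hq₁S (by rw [hd]; exact padicValRat_negTriple_q₁ hpq₁ hne)
          (hrel q₁ hq₁.out (Or.inr (Or.inl rfl)))
      by_cases hv₂ : natGenerator v = q₂
      · exact twist_case q₂ v hv₂ (hv₂ ▸ hℓ2) hq₂S (by rw [hd]; exact padicValRat_negTriple_q₂ hpq₂ hne)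
          (hrel q₂ hq₂.out (Or.inr (Or.inr rfl)))
      -- a good prime of the twist
      haveI : Fact (natGenerator v).Prime := ⟨hℓ⟩
      obtain ⟨hpa, hpb⟩ := hsupp (natGenerator v) hℓ hvS hvp hv₁ hv₂
      obtain ⟨m, hm0, hmd, hma⟩ := exists_unit_int_rep (ℓ := natGenerator v) a hpa
      obtain ⟨m', hm0', hmd', hmb⟩ := exists_unit_int_rep (ℓ := natGenerator v) b hpb
      have hgoodv : (E.quadraticTwist d).HasGoodReductionAt v := by
        by_contra hbad
        have hdvd := ((E.quadraticTwist d).dvd_conductorNorm_iff v).mpr hbad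
        have hdZ0 : (-(p : ℤ) * (q₁ * q₂) : ℤ) ≠ 0 := by
          have h1 : (p : ℤ) ≠ 0 := by exact_mod_cast hp.out.ne_zero
          have h2 : (q₁ : ℤ) ≠ 0 := by exact_mod_cast hq₁.out.ne_zero
          have h3 : (q₂ : ℤ) ≠ 0 := by exact_mod_cast hq₂.out.ne_zero
          exact mul_ne_zero (neg_ne_zero.mpr h1) (mul_ne_zero h2 h3)
        have hndvd : ¬ ((natGenerator v : ℕ) : ℤ) ∣ (-(p : ℤ) * (q₁ * q₂)) := by
          rw [neg_mul, dvd_neg]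
          intro hd'
          have hpr : Prime ((natGenerator v : ℕ) : ℤ) := Nat.prime_iff_prime_int.mp hℓ
          rcases hpr.dvd_or_dvd hd' with h1 | h1
          · exact hvp ((Nat.prime_dvd_prime_iff_eq hℓ hp.out).mp (Int.natCast_dvd_natCast.mp h1))
          · rcases hpr.dvd_or_dvd h1 with h2 | h2
            · exact hv₁ ((Nat.prime_dvd_prime_iff_eq hℓ hq₁.out).mp (Int.natCast_dvd_natCast.mp h2))
            · exact hv₂ ((Nat.prime_dvd_prime_iff_eq hℓ hq₂.out).mp (Int.natCast_dvd_natCast.mp h2))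
        have hnot := not_dvd_conductorNorm_quadraticTwist_of_not_dvd E hℓ hℓ2 (hN _ hℓ hvS) hdZ0 hndvd
        rw [show (((-(p : ℤ) * (q₁ * q₂) : ℤ)) : ℚ) = d by rw [hd]; push_cast; ring] at hnot
        exact hnot hdvd
      exact (E.quadraticTwist d).twoDescentClass_mem_selmerLocalKer_of_mk_eq_intCast h' v hℓ2 hgoodv a b m m' hm0 hm0'
        hma hmb hmd hmd'
  · -- the real place: both components have the same sign
    rcases lt_or_gt_of_ne a.ne_zero with han | hap
    · have hbn : (b : ℚ) < 0 := by
        have : signBit (b : ℚ) = 1 := by rw [← hsign, signBit, if_pos han]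
        by_contra hb'
        rw [signBit, if_neg hb'] at this
        exact zero_ne_one this
      refine twoDescentClass_mem_selmerLocalKer_of_isSquare_T₂ (E.quadraticTwist d) h' _
        (charZero_of_injective_algebraMap (algebraMap ℚ _).injective) a b ?_ ?_
      · refine isSquare_algebraMap_completion_of_pos w (mul_pos_of_neg_of_neg han ?_)
        rw [← mul_sub]; exact mul_neg_of_neg_of_pos hdneg (by linarith)
      · refine isSquare_algebraMap_completion_of_pos w (mul_pos_of_neg_of_neg hbn ?_)
        rw [← mul_sub, ← mul_sub, show d * (e₂ - e₁) * (d * (e₂ - e₃)) = d ^ 2 * ((e₂ - e₁) * (e₂ - e₃)) by ring]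
        exact mul_neg_of_pos_of_neg (by positivity) (mul_neg_of_pos_of_neg (by linarith) (by linarith))
    · have hbp : 0 < (b : ℚ) := by
        have : signBit (b : ℚ) = 0 := by rw [← hsign, signBit, if_neg (not_lt.mpr hap.le)]
        exact (signBit_eq_zero_iff b.ne_zero).mp this
      exact twoDescentClass_mem_selmerLocalKer_of_isSquare (E.quadraticTwist d) h' _
        (charZero_of_injective_algebraMap (algebraMap ℚ _).injective) a b
        (isSquare_algebraMap_completion_of_pos w hap) (isSquare_algebraMap_completion_of_pos w hbp)

/-- **The frame conditions of a Selmer class of `E^{(d)}`** (necessity): for `c' ∈ Sel⁽²⁾(E^{(d)}/ℚ)` with components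
`[a], [b]` (for the roots `d e₁, d e₂, d e₃`): even valuations off `S ∪ {p,q₁,q₂}`, `c_E(a,b)` in `E`'s local condition
at the primes of `S`, the `I₀*` relations at `p, q₁, q₂`, and `sgn a = sgn b`.
[cite: SilvermanAEC2009, Prop. X.1.4, Prop. X.4.9] [cite: MazurRubin2010, Lemma 2.10, Lemma 2.11] -/
theorem frame_of_twist_mem_selmerGroup (h : E.toAffine.SplitTwoTorsion e₁ e₂ e₃)
    (h12 : e₁ < e₂) (h23 : e₂ < e₃)
    (hgood : ∀ ℓ : ℕ, (hℓ : ℓ.Prime) → ℓ ∉ S → haveI : Fact ℓ.Prime := ⟨hℓ⟩;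
      padicValRat ℓ (e₁ - e₂) = 0 ∧ padicValRat ℓ (e₁ - e₃) = 0 ∧ padicValRat ℓ (e₂ - e₃) = 0)
    (hpS : p ∉ S) (hq₁S : q₁ ∉ S) (hq₂S : q₂ ∉ S) (hpq₁ : p ≠ q₁) (hpq₂ : p ≠ q₂) (hne : q₁ ≠ q₂)
    (hp8 : p % 8 = 7) (hq₁4 : q₁ % 4 = 3) (hq₂4 : q₂ % 4 = 3) (hM8 : ((q₁ : ℤ) * q₂) % 8 = 1)
    (hsplitp : ∀ ℓ ∈ S, (hℓ : ℓ.Prime) → ℓ ≠ 2 → haveI : Fact ℓ.Prime := ⟨hℓ⟩; legendreSym ℓ (-(p : ℤ)) = 1)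
    (hsplitM : ∀ ℓ ∈ S, (hℓ : ℓ.Prime) → ℓ ≠ 2 → haveI : Fact ℓ.Prime := ⟨hℓ⟩; legendreSym ℓ ((q₁ : ℤ) * q₂) = 1)
    {d : ℚ} (hd : d = -(p : ℚ) * ((q₁ : ℚ) * q₂)) [(E.quadraticTwist d).IsElliptic]
    {c' : galH1Torsion (E.quadraticTwist d) 2} (hc' : c' ∈ selmerGroup (E.quadraticTwist d) 2) (a b : ℚˣ)
    (ha : kummerEquiv ℚ 2 ((E.quadraticTwist d).twoTorsionCharH1 (h.quadraticTwist d) c') = Additive.ofMul (QuotientGroup.mk a))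
    (hb : kummerEquiv ℚ 2 ((E.quadraticTwist d).twoTorsionCharH1 (h.quadraticTwist d).swap₁₂ c') =
      Additive.ofMul (QuotientGroup.mk b)) :
    (∀ ℓ : ℕ, (hℓ : ℓ.Prime) → ℓ ∉ S → ℓ ≠ p → ℓ ≠ q₁ → ℓ ≠ q₂ → haveI : Fact ℓ.Prime := ⟨hℓ⟩;
        parityBit ℓ (a : ℚ) = 0 ∧ parityBit ℓ (b : ℚ) = 0) ∧
      (∀ v : HeightOneSpectrum (𝓞 ℚ), natGenerator v ∈ S →
        E.twoDescentClass h a b ∈ selmerLocalKer E (v.adicCompletion ℚ) 2) ∧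
      (∀ q : ℕ, (hq : q.Prime) → (q = p ∨ q = q₁ ∨ q = q₂) → haveI : Fact q.Prime := ⟨hq⟩;
        qrBit q (a : ℚ) = parityBit q (a : ℚ) * (qrBit q d + qrBit q (e₂ - e₁)) +
            parityBit q (b : ℚ) * qrBit q ((e₁ - e₂) * (e₁ - e₃)) ∧
          qrBit q (b : ℚ) = parityBit q (a : ℚ) * qrBit q ((e₂ - e₁) * (e₂ - e₃)) +
            parityBit q (b : ℚ) * (qrBit q d + qrBit q (e₁ - e₂))) ∧
      signBit (a : ℚ) = signBit (b : ℚ) := by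
  have h' := h.quadraticTwist d
  have hp0 : (0 : ℚ) < p := by exact_mod_cast hp.out.pos
  have hq₁0 : (0 : ℚ) < q₁ := by exact_mod_cast hq₁.out.pos
  have hq₂0 : (0 : ℚ) < q₂ := by exact_mod_cast hq₂.out.pos
  have hdneg : d < 0 := by rw [hd]; nlinarith [mul_pos hq₁0 hq₂0]
  have hd0 : d ≠ 0 := hdneg.ne
  have hc_eq : c' = (E.quadraticTwist d).twoDescentClass h' a b := (E.quadraticTwist d).eq_twoDescentClass_of_kummerEquiv_eq h' a b ha hb
  -- valuation of `d` at a prime outside `{p, q₁, q₂}` is `0`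
  have hvd : ∀ ℓ : ℕ, (hℓ : ℓ.Prime) → ℓ ≠ p → ℓ ≠ q₁ → ℓ ≠ q₂ → haveI : Fact ℓ.Prime := ⟨hℓ⟩; padicValRat ℓ d = 0 := by
    intro ℓ hℓ h1 h2 h3
    haveI : Fact ℓ.Prime := ⟨hℓ⟩
    rw [hd, padicValRat.mul (neg_ne_zero.mpr hp0.ne') (mul_ne_zero hq₁0.ne' hq₂0.ne'), padicValRat.neg,
      padicValRat.mul hq₁0.ne' hq₂0.ne', show (p : ℚ) = ((p : ℕ) : ℚ) from rfl, show (q₁ : ℚ) = ((q₁ : ℕ) : ℚ) from rfl,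
      show (q₂ : ℚ) = ((q₂ : ℕ) : ℚ) from rfl, padicValRat.of_nat, padicValRat.of_nat, padicValRat.of_nat,
      padicValNat_primes h1, padicValNat_primes h2, padicValNat_primes h3]
    rfl
  refine ⟨fun ℓ hℓ hℓS h1 h2 h3 => ?_, fun v hvS => ?_, fun q hq hqT => ?_, ?_⟩
  · haveI : Fact ℓ.Prime := ⟨hℓ⟩
    obtain ⟨g12, g13, g23⟩ := hgood ℓ hℓ hℓS
    set v : HeightOneSpectrum (𝓞 ℚ) := (primesEquiv (R := 𝓞 ℚ)).symm ⟨ℓ, hℓ⟩ with hv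
    have hgen : (primesEquiv (R := 𝓞 ℚ) v : ℕ) = ℓ := congrArg Subtype.val ((primesEquiv (R := 𝓞 ℚ)).apply_symm_apply ⟨ℓ, hℓ⟩)
    have hdℓ := hvd ℓ hℓ h1 h2 h3
    have v12 : padicValRat ℓ (d * e₁ - d * e₂) = 0 := by
      rw [← mul_sub, padicValRat.mul hd0 (sub_ne_zero.mpr h.ne₁₂), hdℓ, g12, add_zero]
    have v13 : padicValRat ℓ (d * e₁ - d * e₃) = 0 := by
      rw [← mul_sub, padicValRat.mul hd0 (sub_ne_zero.mpr h.ne₁₃), hdℓ, g13, add_zero]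
    have v21 : padicValRat ℓ (d * e₂ - d * e₁) = 0 := by rw [← neg_sub, padicValRat.neg, v12]
    have v23 : padicValRat ℓ (d * e₂ - d * e₃) = 0 := by
      rw [← mul_sub, padicValRat.mul hd0 (sub_ne_zero.mpr h.ne₂₃), hdℓ, g23, add_zero]
    have ea := (E.quadraticTwist d).even_padicValRat_of_mem_selmerGroup h' hc' v (by rw [hgen]; exact v12)
      (by rw [hgen]; exact v13) a ha
    have eb := (E.quadraticTwist d).even_padicValRat_of_mem_selmerGroup h'.swap₁₂ hc' v (by rw [hgen]; exact v21)
      (by rw [hgen]; exact v23) b hb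
    rw [hgen] at ea eb
    exact ⟨parityBit_eq_zero_iff.mpr ea, parityBit_eq_zero_iff.mpr eb⟩
  · have hsq := isSquare_negTriple_adicCompletion S hpS hq₁S hq₂S hp8 hq₁4 hq₂4 hM8 hsplitp hsplitM v hvS
    rw [← hd] at hsq
    have hloc' := ((mem_selmerGroup_iff _ _ _).mp hc').1 v
    rw [hc_eq] at hloc'
    exact (E.twoDescentClass_quadraticTwist_mem_selmerLocalKer_iff (v.adicCompletion ℚ)
      (charZero_of_injective_algebraMap (algebraMap ℚ _).injective) h hsq a b).mp hloc'
  · haveI : Fact q.Prime := ⟨hq⟩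
    have hqS : q ∉ S := by rcases hqT with rfl | rfl | rfl <;> assumption
    obtain ⟨g12, g13, g23⟩ := hgood q hq hqS
    have hqd : padicValRat q d = 1 := by
      rw [hd]
      rcases hqT with rfl | rfl | rfl
      · exact padicValRat_negTriple_p hpq₁ hpq₂
      · exact padicValRat_negTriple_q₁ hpq₁ hne
      · exact padicValRat_negTriple_q₂ hpq₂ hne
    exact E.qrBit_rel_quadraticTwist_of_mem_selmerGroup h hqd g12 g13 g23 hc' a b ha hb
  · have hab := (E.quadraticTwist d).mul_pos_of_mem_selmerGroup_of_gt h' (mul_lt_mul_of_neg_left h12 hdneg)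
      (mul_lt_mul_of_neg_left h23 hdneg) hc' a b ha hb
    rcases lt_or_gt_of_ne a.ne_zero with han | hap
    · have hbn : (b : ℚ) < 0 := by
        by_contra hb'
        have := mul_nonpos_of_nonpos_of_nonneg han.le (not_lt.mp hb')
        linarith
      rw [signBit, signBit, if_pos han, if_pos hbn]
    · have hbp : 0 < (b : ℚ) := pos_of_mul_pos_right hab hap.le
      rw [(signBit_eq_zero_iff a.ne_zero).mpr hap, (signBit_eq_zero_iff b.ne_zero).mpr hbp]

end Summit.BirchSwinnertonDyer.BirchSwinnertonDyer.Theorems.GenusKolyvaginAtTwo.TorsionCellD0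

end
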